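import Summits.BirchSwinnertonDyer.Rank1Residual.P2.CongruentNumberThetaCriterionCosets
import HarnessLib
import HarnessLib.Audit.Tags

/-!
# Cell «bsd-monsky» (prover-B): route B's operator `θ` for ALL square-free `n ≡ 6 (mod 8)` — the UNIFORM Θ-criterion,
# part 2: the `θ`-package `θ = θ^{(n)}` with (E5)/(E6)/(E7) at EVERY block (kernel lemmas; nothing asserted, nothing booked)

HONEST FRAMING (cell `bsd-monsky`, run/shared/lean/pub/bsd-monsky/; README §1/§3): the cell's CLAIMED theorem is Monsky's 1990
conjecture on the `k = 2` family `𝒮⁻`; «ℓ ≥ 3 rungs (C-P2-2 for k ≥ 3) are NOT claimed — record what the same argument gives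
there, no more». THIS FILE IS PART OF THAT RECORD IN THE KERNEL, in its FINAL, UNIFORM form: the Θ-criterion of the scope note
HOME/proof/PROOF-B-K3-SCOPE.md §3 (prover-B g6) for ALL square-free `n ≡ 6 (mod 8)` at once — route B's «Tian induction on the
number of prime factors» — instead of one descent file per `k = 3` type (g8: `P2/CongruentNumberThetaThreePrimes*.lean`).
Nothing is asserted: every statement is a kernel implication from the displayed printed sentences of
`Literature/…/TianYuanZhang2017/GenusPointDescentDisplays.lean` (`recursion`, `epsSpec`, `thm35Main`, `lemma318`, `scriptLSpec`)
and `…/CMPointGaloisDisplays.lean` (`CMBlockSpec`, `ThetaBlockSpec`, `SevenBlockSpec`, `ConjSpec` — TYZ §3.1–3.2 / Prop. 3.2 /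
Thm. 3.6 / p. 759 AS PRINTED, every block) taken as data/hypotheses (the hypotheses the named fact `tyz_cmPointGaloisData`
provides); no conjecture is discharged, no count moves, no class is booked. NOT refereed; not part of PROOF-B v1.3 or of the paper.
No new definition is introduced: the control condition, the coset predicate and the Θ-certificate are written out in full.

THE CRITERION (three files: `…ThetaCriterionCosets` = cosets, residues, square-root bookkeeping, (E5) for composite blocks;
`…ThetaCriterionPackage` = the `θ`-package for general `n`; `…ThetaCriterion` = the block induction and the theorem).
Let `n ≡ 6 (mod 8)` be square-free, `θ = θ^{(n)}` the top block's lift of `σ_{1+ϖ}` (display (G8)), `w = τ((1−i)/2)` (`2w = 0`,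
`θw + w = τ(1)`). TYZ's recursion `P(d) = Z(d) − Σ_{d₀ ∈ R(d)} ε(d₀, d/d₀)𝓛(d/d₀)P(d₀)` runs over blocks `d ∣ n`, `d ≡ 5, 6, 7
(mod 8)`; from a `6`-block the steps (block, cofactor mod 8) are `(6,1)` and `(7,2)`, from a `7`-block `(7,1)` and `(5,3)`
(`ε = ±i`), from a GOOD `5`-block (all primes `≡ 1 (mod 4)`) only `(5,1)` to good `5`-blocks. Block evaluations: (E6)
`(θ−1)Z(d) ∈ g(d)w + ℤτ(1)` for every `6`-block (J759: compare `θ^{(n)}` with `θ^{(d)}`); (E7) `(θ−1)Z(d) = 0` for every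
`7`-block (Prop. 3.2 (3)); (E5) `(θ+1)Z(d) ∈ ℤτ(1)` for every good `5`-block (Thm. 3.6 (1) + `c` inverting `Cl′_d`); and
`(θ ∓ 1)∘[i] = −[i]∘(θ ± 1)`. CONTROL in closed form: `n` is `θ`-controlled iff every `7`-block `d₀ ∣ n` with `n/d₀ ≡ 2
(mod 8)` has only good `5`-divisors (the `[3,3,7]` obstruction of the scope census and nothing else; always at `k = 2`).
VALUE: a Θ-certificate `s : ℕ → ℤ/2` with `s(e) = g(e) + Σ_{d₀ ∈ R(e), d₀ ≡ 6} 𝓛(e/d₀)s(d₀)` on the `6`-blocks `e ∣ n` with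
`n/e ≡ 1 (mod 8)` (`Θ(n) := s(n)` = the sum over chains of `6`-blocks of `(∏𝓛)·g`). THEOREM (`odd_scriptL_of_thetaCert`):
`θ`-controlled, `Θ(n) = 1`, rank `E_n(ℚ) ≤ 1` once `𝓛(n) ≠ 0` ⟹ `𝓛(n)` odd; hence `ord_{s=1} L(E_n, s) = 1` from the display
ALONE (`analyticRank_eq_one_of_thetaCert_of_cmPointGaloisData`). Instances: THEOREM B (`k = 2`, `Θ = g(2pq)`), g8's
THEOREM B₃ for `(5,5,7)` (`Θ = g(n) + 𝓛(p₁p₂)g(2p₃)`) and `(3,7,7)`.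

References: [TianYuanZhang2017] §3.1 (J738–J739), Prop. 3.2 (1)(2)(3), Thm. 3.3 (ε), Thm. 3.5, Thm. 3.6 (1)(2) (J741),
Lemma 3.18, proofs of Lemma 3.15 (J750) and Lemma 3.21 (J759), §2.1 (J725); HOME/proof/PROOF-B.md v1.3 §4–§8, §10;
HOME/proof/PROOF-B-K3-SCOPE.md §2–§5; HOME/proof/PROOF-B-THETA-CRITERION.md (this generation's companion note).

THIS FILE: §5 the `θ`-package for general `n` (`theta_package`: from `CMPointGaloisPrinted`, `θ^{(n)}` has `θ(√−n) = √−n`,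
`θ(i) = −i`, `θ(√−2) = −√−2`, (E6) at every `6`-block, (E7) at every `7`-block, (E5) at every good `5`-block — the per-type
packages `theta_package_557/377` of g8 for all `n` at once).
-/

noncomputable section

open scoped Classical

open WeierstrassCurve WeierstrassCurve.Affine Literature.NumberTheory.EllipticCurves
  Literature.NumberTheory.EllipticCurves.Rank1Residual
  Literature.NumberTheory.EllipticCurves.Rank1Residual.Typed
  Literature.NumberTheory.EllipticCurves.TianYuanZhang2017
  Literature.NumberTheory.EllipticCurves.TianYuanZhang2017.W2

set_option autoImplicit false

namespace Summit.BirchSwinnertonDyer.Rank1Residual.P2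

namespace ThetaDescent

variable {n : ℕ}

/-! ## §5 The `θ`-package for general `n ≡ 6 (mod 8)`: `θ = θ^{(n)}` and the block evaluations (E5), (E6), (E7) -/

/-- `θ^{(d)}(i) = −i` for the lift of `σ_{1+ϖ}` of a `6`-block (Thm. 3.6 (2) with its printed «Thus `z^{σ²_{1+ϖ}} = z + τ(1)`»,
Prop. 3.2 (2) `σ²_{1+ϖ} = σ`). [cite: TianYuanZhang2017, Prop. 3.2 (2) (p0010 L111–L113), Thm. 3.6 (2) (p0012 L31–L33)] -/
theorem theta_im_of_blockSpec (D : GenusPointData n) {d : ℕ} {z : APoint D.H} {Φ : Finset (D.H ≃ₐ[ℚ] D.H)}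
    {ΓH ΓH' : Subgroup (D.H ≃ₐ[ℚ] D.H)} {σ c θd : D.H ≃ₐ[ℚ] D.H} (hB : D.CMBlockSpec d z Φ ΓH ΓH' σ c)
    (hT : D.ThetaBlockSpec d z ΓH ΓH' σ θd) : θd D.im = -D.im := by
  obtain ⟨-, -, ⟨hΓ'z, -, -⟩, -, -, ⟨-, -, hσz⟩, -⟩ := hB
  obtain ⟨-, ⟨m₀, h36⟩, -, hθθσ⟩ := hT
  have hsq : thetaPt D θd (thetaPt D θd z) = z + tauOne := by
    have hmul : θd * θd = θd * θd * σ⁻¹ * σ := by group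
    rw [← thetaPt_mul, hmul, thetaPt_mul]
    show thetaPt D _ (D.galPt σ z) = _
    rw [hσz, map_add, (thetaPt_tauOne_tauHalf D _).1]
    show D.galPt _ z + tauOne = _
    rw [hΓ'z _ hθθσ]
  exact theta_im_eq_neg_of_thm36 D θd z m₀ h36 hsq

/-- `g(√−2) = −√−2` for an automorphism of a `6`-block `d = 2e` with `g(i) = −i`, `g(√−d) = √−d`, `g(√−e) = √−e`
(`(√−e·√−2)² = (i√−d)²`). [cite: TianYuanZhang2017, §3.1 (p0011 L60–L64)] -/
theorem sqrtNeg_two_eq_neg_of_six (D : GenusPointData n) {d : ℕ} (hdn : d ∈ n.divisors) (h2n : 2 ∈ n.divisors)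
    (hen : d / 2 ∈ n.divisors) (hd : d = 2 * (d / 2)) (g : D.H ≃ₐ[ℚ] D.H) (hgi : g D.im = -D.im)
    (hgd : g (D.sqrtNeg d) = D.sqrtNeg d) (hge : g (D.sqrtNeg (d / 2)) = D.sqrtNeg (d / 2)) :
    g (D.sqrtNeg 2) = -D.sqrtNeg 2 := by
  have hsq : (D.sqrtNeg (d / 2) * D.sqrtNeg 2) ^ 2 = (D.im * D.sqrtNeg d) ^ 2 := by
    rw [mul_pow, mul_pow, D.im_sq, D.sqrtNeg_sq _ hen, D.sqrtNeg_sq _ h2n, D.sqrtNeg_sq _ hdn]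
    conv_rhs => rw [hd]
    push_cast; ring
  have hy : g (D.im * D.sqrtNeg d) = -(D.im * D.sqrtNeg d) := by rw [map_mul, hgi, hgd]; ring
  exact neg_of_neg_mul_left D g (sqrtNeg_ne_zero D hen) hge (neg_of_sq_eq_sq D g hsq hy)

/-- The values of an automorphism of `Gal(ℍ′_n/H_d)`-type on the `√−p`, `p ∣ d` prime: if `g(i) = −i`, `g(√−2) = −√−2`
(when `2 ∣ d`) and `g` fixes the genus roots `√(p*)` of the odd primes `p ∣ d`, then `g(√−p) = −√−p` for `p = 2` or
`p ≡ 1 (mod 4)` and `g(√−p) = √−p` for `p ≡ 3 (mod 4)`. [cite: TianYuanZhang2017, §2.1 (J725 L11–L16), §3.1 (p0011 L60–L64)] -/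
theorem apply_sqrtNeg_prime_of_genus (D : GenusPointData n) {d : ℕ} (g : D.H ≃ₐ[ℚ] D.H) (hgi : g D.im = -D.im)
    (hg2 : 2 ∣ d → g (D.sqrtNeg 2) = -D.sqrtNeg 2)
    (hgen : ∀ p ∈ d.divisors, Odd p → 1 < p → g (D.genusRoot p) = D.genusRoot p) {p : ℕ} (hp : p.Prime)
    (hpd : p ∈ d.divisors) :
    g (D.sqrtNeg p) = if p % 4 = 3 then D.sqrtNeg p else -D.sqrtNeg p := by
  by_cases hp2 : p = 2
  · subst hp2
    rw [if_neg (by omega)]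
    exact hg2 (Nat.mem_divisors.mp hpd).1
  · have hpodd : Odd p := hp.odd_of_ne_two hp2
    have hfix := hgen p hpd hpodd hp.one_lt
    unfold GenusPointData.genusRoot at hfix
    rcases Nat.odd_mod_four_iff.mp (Nat.odd_iff.mp hpodd) with h1 | h3
    · rw [if_pos h1] at hfix
      rw [if_neg (by omega)]
      exact theta_sqrtNeg_eq_neg_of_fix_mul D g hgi _ hfix
    · rw [if_neg (by omega)] at hfix
      rw [if_pos h3]
      exact hfix

/-- **The `θ`-evaluation package for GENERAL square-free `n ≡ 6 (mod 8)`.** From `D.CMPointGaloisPrinted` (TYZ §3.1–3.2 /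
Prop. 3.2 / Thm. 3.6 / p. 759, every block): the top block's lift `θ = θ^{(n)}` of `σ_{1+ϖ}` satisfies `θ(√−n) = √−n`,
`θ(i) = −i`, `θ(√−2) = −√−2`, and (E6) `(θ−1)Z(d) ∈ g(d)·w + ℤτ(1)` for EVERY block `d ≡ 6`, (E7) `θ·Z(d) = Z(d)` for every
block `d ≡ 7`, (E5) `θ·Z(d) + Z(d) ∈ ℤτ(1)` for every GOOD block `d ≡ 5 (mod 8)`.
[cite: TianYuanZhang2017, §3.1 (J738–J739), Prop. 3.2 (1)(2)(3), Thm. 3.6 (1)(2) (J741), proof of Lemma 3.21 (J759), proof of Lemma 3.15 (J750), §2.1 (J725)] -/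
theorem theta_package (hsq : Squarefree n) (h6 : n % 8 = 6) (D : GenusPointData n) (hG : D.CMPointGaloisPrinted) :
    ∃ θ : D.H ≃ₐ[ℚ] D.H,
      θ (D.sqrtNeg n) = D.sqrtNeg n ∧ θ D.im = -D.im ∧ θ (D.sqrtNeg 2) = -D.sqrtNeg 2 ∧
      (∀ d ∈ n.divisors, d % 8 = 6 →
        ∃ M : ℤ, thetaPt D θ (D.Z d) - D.Z d = (gK d : ℤ) • D.tauHalfOneMinusI + M • tauOne) ∧
      (∀ d ∈ n.divisors, d % 8 = 7 → thetaPt D θ (D.Z d) = D.Z d) ∧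
      (∀ d ∈ n.divisors, d % 8 = 5 → (∀ p ∈ d.primeFactors, p % 4 = 1) →
        thetaPt D θ (D.Z d) + D.Z d ∈ AddSubgroup.zmultiples (tauOne : APoint D.H)) := by
  obtain ⟨z, Φ, ΓH, ΓH', σ, θ, c, ⟨hci, hcd, hcc⟩, hblk⟩ := hG
  have hn0 : n ≠ 0 := hsq.ne_zero
  have hn : n ∈ n.divisors := Nat.mem_divisors_self _ hn0
  have h2n : 2 ∈ n.divisors := Nat.mem_divisors.mpr ⟨Nat.dvd_of_mod_eq_zero (by omega), hn0⟩
  -- a `6`-block `d`: `d = 2e`, `e ≡ 3 (mod 4)`, `1 < e`, `e ∣ d`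
  have six : ∀ d ∈ n.divisors, d % 8 = 6 →
      d / 2 ∈ n.divisors ∧ d / 2 ∈ d.divisors ∧ d = 2 * (d / 2) ∧ Odd (d / 2) ∧ (d / 2) % 4 = 3 ∧ 1 < d / 2 ∧
        d ∈ d.divisors ∧ 1 < d := by
    intro d hd hd6
    obtain ⟨hdd, -⟩ := Nat.mem_divisors.mp hd
    have hd2 : d = 2 * (d / 2) := by omega
    have he : d / 2 ∣ d := ⟨2, by omega⟩
    refine ⟨Nat.mem_divisors.mpr ⟨he.trans hdd, hn0⟩, Nat.mem_divisors.mpr ⟨he, by omega⟩, hd2,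
      Nat.odd_iff.mpr (by omega), by omega, by omega, Nat.mem_divisors_self _ (by omega), by omega⟩
  -- the top block
  obtain ⟨hBn, hTn, -⟩ := hblk _ hn
  have hBn' := hBn (Or.inr h6)
  have hTn' := hTn h6
  set Θ := θ n with hΘdef
  have hΘi : Θ D.im = -D.im := theta_im_of_blockSpec D hBn' hTn'
  obtain ⟨-, -, -, ⟨-, hΓngen⟩, -, -, -⟩ := hBn'
  obtain ⟨hΘK, -, hΘH, -⟩ := hTn'
  obtain ⟨-, hΘgen⟩ := hΓngen Θ hΘH
  obtain ⟨hmn, hmn', hnm, hmodd, hm3, hm1, -, -⟩ := six n hn h6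
  have hgm : D.genusRoot (n / 2) = D.sqrtNeg (n / 2) := by
    unfold GenusPointData.genusRoot; rw [if_neg (by omega)]
  have hΘm : Θ (D.sqrtNeg (n / 2)) = D.sqrtNeg (n / 2) := by rw [← hgm]; exact hΘgen _ hmn hmodd hm1
  have hΘ2 : Θ (D.sqrtNeg 2) = -D.sqrtNeg 2 := sqrtNeg_two_eq_neg_of_six D hn h2n hmn hnm Θ hΘi hΘK hΘm
  -- `Θ` on `√−p`, `p ∣ n` prime
  have hΘp : ∀ p : ℕ, p.Prime → p ∣ n → Θ (D.sqrtNeg p) = if p % 4 = 3 then D.sqrtNeg p else -D.sqrtNeg p :=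
    fun p hp hpn => apply_sqrtNeg_prime_of_genus D Θ hΘi (fun _ => hΘ2) hΘgen hp (Nat.mem_divisors.mpr ⟨hpn, hn0⟩)
  refine ⟨Θ, hΘK, hΘi, hΘ2, ?_, ?_, ?_⟩
  · -- (E6) at every `6`-block `d`: compare `Θ` with `θ^{(d)}`
    intro d hd hd6
    obtain ⟨hBd, hTd, -⟩ := hblk _ hd
    have hBd' := hBd (Or.inr hd6)
    have hTd' := hTd hd6
    have hθdi : θ d D.im = -D.im := theta_im_of_blockSpec D hBd' hTd'
    obtain ⟨-, -, -, ⟨-, hΓdgen⟩, -, -, -⟩ := hBd'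
    obtain ⟨hθdK, -, hθdH, -⟩ := hTd'
    obtain ⟨-, hθdgen⟩ := hΓdgen (θ d) hθdH
    obtain ⟨hen, hed, hde, heodd, he3, he1, hdd, hd1⟩ := six d hd hd6
    have hge : D.genusRoot (d / 2) = D.sqrtNeg (d / 2) := by
      unfold GenusPointData.genusRoot; rw [if_neg (by omega)]
    have hθde : θ d (D.sqrtNeg (d / 2)) = D.sqrtNeg (d / 2) := by rw [← hge]; exact hθdgen _ hed heodd he1
    have hθd2 : θ d (D.sqrtNeg 2) = -D.sqrtNeg 2 := sqrtNeg_two_eq_neg_of_six D hd h2n hen hde (θ d) hθdi hθdK hθde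
    have hθdp : ∀ p : ℕ, p.Prime → p ∣ d → θ d (D.sqrtNeg p) = if p % 4 = 3 then D.sqrtNeg p else -D.sqrtNeg p :=
      fun p hp hpd => apply_sqrtNeg_prime_of_genus D (θ d) hθdi (fun _ => hθd2) hθdgen hp
        (Nat.mem_divisors.mpr ⟨hpd, by omega⟩)
    -- `Θ` and `θ^{(d)}` agree on every `√−d′`, `d′ ∣ d`
    have hagree : ∀ d' : ℕ, d' ∣ d → 1 < d' → Θ (D.sqrtNeg d') = θ d (D.sqrtNeg d') :=
      apply_sqrtNeg_eq_of_forall_prime D hd Θ (θ d) (by rw [hΘi, hθdi]) fun p hp hpd => by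
        rw [hΘp p hp (hpd.trans (Nat.mem_divisors.mp hd).1), hθdp p hp hpd]
    have hΘd : Θ (D.sqrtNeg d) = D.sqrtNeg d := by rw [hagree d dvd_rfl hd1, hθdK]
    have hα : D.TrivialOnL d (Θ * (θ d)⁻¹) := by
      refine ⟨?_, fun d' hd' hd'1 => ?_⟩
      · rw [AlgEquiv.mul_apply, inv_apply_eq_neg_of_apply_eq_neg D (θ d) hθdi, map_neg, hΘi, neg_neg]
      · have hd'n : d' ∈ n.divisors :=
          Nat.mem_divisors.mpr ⟨(Nat.mem_divisors.mp hd').1.trans (Nat.mem_divisors.mp hd).1, hn0⟩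
        exact mul_inv_apply_eq_self_of_apply_eq D Θ (θ d) _ _ (sqrtNeg_sq_ratCast D hd'n)
          (hagree d' (Nat.mem_divisors.mp hd').1 hd'1)
    exact theta_sub_Z_of_six_block D hdd hd1 (hBd (Or.inr hd6)) (hTd hd6) Θ hΘd hα
  · -- (E7) at every `7`-block `d`: `Θ` fixes the genus field of `K_d`
    intro d hd hd7
    obtain ⟨-, -, hS⟩ := hblk _ hd
    have hdodd : Odd d := Nat.odd_iff.mpr (by omega)
    have hgd : D.genusRoot d = D.sqrtNeg d := by
      unfold GenusPointData.genusRoot; rw [if_neg (by omega)]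
    refine hS hd7 Θ ⟨?_, fun d' hd' hd'o hd'1 => ?_⟩
    · rw [← hgd]; exact hΘgen d hd hdodd (by omega)
    · exact hΘgen d' (Nat.mem_divisors.mpr ⟨(Nat.mem_divisors.mp hd').1.trans (Nat.mem_divisors.mp hd).1, hn0⟩)
        hd'o hd'1
  · -- (E5) at every good `5`-block `d`: `Θc` is trivial on `L_d(i)`
    intro d hd hd5 hgood
    have hd0 : d ≠ 0 := fun h => by rw [h] at hd5; omega
    have hagree : ∀ d' : ℕ, d' ∣ d → 1 < d' → Θ (D.sqrtNeg d') = c (D.sqrtNeg d') := by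
      refine apply_sqrtNeg_eq_of_forall_prime D hd Θ c (by rw [hΘi, hci]) fun p hp hpd => ?_
      have hp4 : p % 4 = 1 := hgood p (Nat.mem_primeFactors.mpr ⟨hp, hpd, hd0⟩)
      rw [hΘp p hp (hpd.trans (Nat.mem_divisors.mp hd).1), if_neg (by omega),
        hcd p (Nat.mem_divisors.mpr ⟨hpd.trans (Nat.mem_divisors.mp hd).1, hn0⟩)]
    have hα : D.TrivialOnL d (Θ * c) := by
      refine ⟨?_, fun d' hd' hd'1 => ?_⟩
      · rw [AlgEquiv.mul_apply, hci, map_neg, hΘi, neg_neg]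
      · have hd'n : d' ∈ n.divisors :=
          Nat.mem_divisors.mpr ⟨(Nat.mem_divisors.mp hd').1.trans (Nat.mem_divisors.mp hd).1, hn0⟩
        rw [AlgEquiv.mul_apply, hcd d' hd'n, map_neg, hagree d' (Nat.mem_divisors.mp hd').1 hd'1, hcd d' hd'n, neg_neg]
    exact theta_Z_add_Z_mem_of_fiveGood D hd hd5 hgood ((hblk _ hd).1 (Or.inl hd5)) hcc Θ hα

end ThetaDescent

end Summit.BirchSwinnertonDyer.Rank1Residual.P2

end
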